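import Mathlib.Combinatorics.SetFamily.FourFunctions
import Mathlib.Tactic
import HarnessLib
import HarnessLib.Audit.Tags
import Summits.CriticalPhenomena.PercolationContinuityZ3.Theorems.PercNearOneGluingNoHeavyLowerTailSahiCrossGoodSequence
import Summits.CriticalPhenomena.PercolationContinuityZ3.Theorems.PercNearOneGluingNoHeavyLowerTailSahiCrossFirstStep

/-!
# BLOCK COMPRESSION of a type-set configuration: exact projection onto `G \ Y`, the block step, the CLEAN-MEMBER theorem, and the
# order-free conjecture `CrossMemberFace` (⟹ `CrossSignedColouredDaykin3`)

Support file (seat `prim-masterthm-p1`, gen 44; `--supports stmt-CriticalPhenomena-4575`).  One definition (`blockTypes`), one typed conjecture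
(`CrossMemberFace`), theorems otherwise; no `sorry`, standard axioms.  Memo `run/shared/lean/prim/prim-masterthm/FROM-prim-masterthm-p1-g44-MEMBER-FACE.md`.

THE POINT ([this work]).  Gen 43 compresses ONE point at a time (`…SahiTypeSetDaykinCompress.projTypes`, `typeSet_step`) and asks for a sequence of GOOD steps
(`GoodSeq`, conjecture T_cross).  But the configuration reached after compressing a SET `Y` of points — the traces `z \ Y` with the UNION ("block") type-sets
`blockTypes Z L Y u = ⋃ {L z : z ∈ Z, z \ Y = u}` — does not depend on the order, and neither does the projected meet family: **`typeMeets_block`: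
`typeMeets (Z.image (· \ Y)) (blockTypes Z L Y) = (typeMeets Z L).image (· \ Y)` exactly.**  Consequently the slack identity telescopes,
`slack(Z) = slack(Z^{(Y)}) + 2·(Λ_Y − D_Y)` with `Λ_Y = #typeMeets − #(typeMeets.image (· \ Y))` (meets lost in the block projection) and
`2·D_Y = Σ_{z∈Z} w(L z) − Σ_{u} w(blockTypes u)` (weight lost), so the SUM of the step terms `tw_i − def_i` along any compression order of `Y` is the same
number `Λ_Y − D_Y`; and if `Y` contains a member of `Z` then `∅ ∈ Z^{(Y)}` and the face theorem (`…SahiTypeSetDaykinFace`) closes the count: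
* `block_step` / `block_step'` — **if some member of `Z` lies inside `Y` and `D_Y ≤ Λ_Y` then `Σ_z w(L z) ≤ 2·#typeMeets Z L`** (the conjectured inequality for `Z`).
* `card_add_card_filter_le_of_injOn_sdiff` — **CLEAN BLOCKS (unconditional):** if moreover the trace map `z ↦ z \ Y` is injective on `Z` then `D_Y = 0 ≤ Λ_Y`, so the
  inequality `#Z + #{self-compatible} ≤ 2·#typeMeets` HOLDS — for every type-set configuration, crossing or not.  In the language of `PartitionSignedDaykin`:
  `card_le_card_partDiffs_of_injOn_sdiff` — a complement-free labelled `P` satisfies `#P ≤ #partDiffs` as soon as some member (or complement of a member) `p`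
  separates the signed family (`z ↦ z \ p` injective on `P ⊔ σP`).  This alone settles ALL 1 720 colour-canonical crossing 3-colour configurations of `2^5`
  (every one has such a member; engine `code-g44/c/gin.c`), but only ≈ 55 % of those of `2^6`.
* `CrossMemberFace` (typed, [status: open]) — **the order-free form of T_cross**: every nonempty crossing labelled configuration has a member `p` of its signed
  family with `D_p ≤ Λ_p`.  EVIDENCE: for EVERY member `p` of every crossing 3-colour configuration of `2^5` (exhaustive) and of ≈ 3·10⁵ sampled configurations
  of `2^6`, `2^7` one even has `Λ_p − D_p ≥ 1` (kit j312964: exhaustive `2^6`); T_cross's "some order of the points of `p` is good" implies it, "every order" is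
  not needed, and the 96 exceptional minimum members of kit j311595 all satisfy it (`Λ − D = 2`).  `crossSignedColouredDaykin3_of_crossMemberFace` — the bridge.
HONEST FRAMING: `CrossMemberFace`, `CrossGoodSequence'`, `CrossSignedColouredDaykin3` remain OPEN; the clean-block theorem is unconditional. [this work]
-/

namespace Summit.CriticalPhenomena.PercolationContinuityZ3.Theorems.SahiColouredDaykin

open Finset

variable {α : Type*} [DecidableEq α]

/-! ### 1. Block type-sets -/

section block

variable (Z : Finset (Finset α)) (L : Finset α → Finset (ℕ × Bool)) (Y : Finset α)

/-- The BLOCK (union) type-set of a `Y`-trace `u`: all types carried by members `z ∈ Z` with `z \ Y = u`. [this work] -/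
def blockTypes (u : Finset α) : Finset (ℕ × Bool) := (Z.filter fun z => z \ Y = u).biUnion L

variable {Z L Y}

/-- Membership in a block type-set. [this work] -/
theorem mem_blockTypes {u : Finset α} {t : ℕ × Bool} :
    t ∈ blockTypes Z L Y u ↔ ∃ z ∈ Z, z \ Y = u ∧ t ∈ L z := by
  unfold blockTypes
  simp only [mem_biUnion, mem_filter, and_assoc]

/-- A member's type-set is contained in the block type-set of its trace. [this work] -/
theorem subset_blockTypes_sdiff {z : Finset α} (hz : z ∈ Z) : L z ⊆ blockTypes Z L Y (z \ Y) :=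
  fun _ ht => mem_blockTypes.2 ⟨z, hz, rfl, ht⟩

/-- Trace of a complement: `(G \ Y) \ (z \ Y) = (G \ z) \ Y`. [folklore] -/
theorem sdiff_sdiff_sdiff_comm' (G z Y : Finset α) : (G \ Y) \ (z \ Y) = (G \ z) \ Y := by
  ext a; simp only [mem_sdiff]; tauto

/-- Traces commute with intersection. [folklore] -/
theorem inter_sdiff_distrib' (a b Y : Finset α) : (a ∩ b) \ Y = (a \ Y) ∩ (b \ Y) := by
  ext t; simp only [mem_sdiff, mem_inter]; tauto

variable {G : Finset α}

/-- Traces lie in `G \ Y`. [this work] -/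
theorem blockProj_subset (hZG : ∀ z ∈ Z, z ⊆ G) {u : Finset α} (hu : u ∈ Z.image fun s => s \ Y) : u ⊆ G \ Y := by
  obtain ⟨z, hz, rfl⟩ := mem_image.1 hu
  exact sdiff_subset_sdiff (hZG z hz) le_rfl

/-- The trace family is closed under complement in `G \ Y`. [this work] -/
theorem blockProj_compl_mem (hcc : ∀ z ∈ Z, G \ z ∈ Z) {u : Finset α} (hu : u ∈ Z.image fun s => s \ Y) :
    (G \ Y) \ u ∈ Z.image fun s => s \ Y := by
  obtain ⟨z, hz, rfl⟩ := mem_image.1 hu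
  exact mem_image.2 ⟨G \ z, hcc z hz, (sdiff_sdiff_sdiff_comm' G z Y).symm⟩

/-- Block type-sets of traces are nonempty. [this work] -/
theorem blockTypes_nonempty (hne : ∀ z ∈ Z, (L z).Nonempty) {u : Finset α} (hu : u ∈ Z.image fun s => s \ Y) :
    (blockTypes Z L Y u).Nonempty := by
  obtain ⟨z, hz, rfl⟩ := mem_image.1 hu
  obtain ⟨t, ht⟩ := hne z hz
  exact ⟨t, subset_blockTypes_sdiff hz ht⟩

/-- **Equivariance of block type-sets**: the block type-set of the complementary trace is the flip. [this work] -/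
theorem blockTypes_compl (hZG : ∀ z ∈ Z, z ⊆ G) (hcc : ∀ z ∈ Z, G \ z ∈ Z)
    (hflip : ∀ z ∈ Z, L (G \ z) = (L z).image flipT) {u : Finset α} (hu : u ∈ Z.image fun s => s \ Y) :
    blockTypes Z L Y ((G \ Y) \ u) = (blockTypes Z L Y u).image flipT := by
  obtain ⟨z₀, hz₀, rfl⟩ := mem_image.1 hu
  have hsub : z₀ \ Y ⊆ G \ Y := sdiff_subset_sdiff (hZG z₀ hz₀) le_rfl
  ext t
  rw [mem_blockTypes, mem_image]
  constructor
  · rintro ⟨z', hz', hzu, ht⟩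
    have hz'G := hZG z' hz'
    have e : (G \ z') \ Y = z₀ \ Y := by
      rw [← sdiff_sdiff_sdiff_comm' G z' Y, hzu, Finset.sdiff_sdiff_eq_self hsub]
    have hL : L z' = (L (G \ z')).image flipT := by
      have := hflip (G \ z') (hcc z' hz')
      rwa [Finset.sdiff_sdiff_eq_self hz'G] at this
    rw [hL, mem_image] at ht
    obtain ⟨t₀, ht₀, rfl⟩ := ht
    exact ⟨t₀, mem_blockTypes.2 ⟨G \ z', hcc z' hz', e, ht₀⟩, rfl⟩
  · rintro ⟨t₀, ht₀, rfl⟩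
    obtain ⟨z, hz, hzu, ht₀L⟩ := mem_blockTypes.1 ht₀
    refine ⟨G \ z, hcc z hz, ?_, ?_⟩
    · rw [← sdiff_sdiff_sdiff_comm', hzu]
    · rw [hflip z hz]; exact mem_image_of_mem _ ht₀L

/-- **The block projection is a type-set configuration on `G \ Y`** (the four hypotheses of `TypeSetSignedDaykin`). [this work] -/
theorem blockTypes_config (hZG : ∀ z ∈ Z, z ⊆ G) (hcc : ∀ z ∈ Z, G \ z ∈ Z) (hne : ∀ z ∈ Z, (L z).Nonempty)
    (hflip : ∀ z ∈ Z, L (G \ z) = (L z).image flipT) :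
    (∀ u ∈ Z.image (fun s => s \ Y), u ⊆ G \ Y) ∧
    (∀ u ∈ Z.image (fun s => s \ Y), (G \ Y) \ u ∈ Z.image (fun s => s \ Y)) ∧
    (∀ u ∈ Z.image (fun s => s \ Y), (blockTypes Z L Y u).Nonempty) ∧
    (∀ u ∈ Z.image (fun s => s \ Y), blockTypes Z L Y ((G \ Y) \ u) = (blockTypes Z L Y u).image flipT) :=
  ⟨fun _ hu => blockProj_subset hZG hu, fun _ hu => blockProj_compl_mem hcc hu, fun _ hu => blockTypes_nonempty hne hu,
    fun _ hu => blockTypes_compl hZG hcc hflip hu⟩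

/-! ### 2. Exact block projection of the compatible meets -/

/-- **Exact block projection**: the compatible meets of the block configuration are EXACTLY the traces of the compatible meets — for every `Y`,
independently of any compression order. [this work] -/
theorem typeMeets_block :
    typeMeets (Z.image fun s => s \ Y) (blockTypes Z L Y) = (typeMeets Z L).image fun s => s \ Y := by
  ext w
  constructor
  · intro hw
    obtain ⟨u, _, v, _, hc, rfl⟩ := mem_typeMeets_iff.1 hw
    obtain ⟨t, ht, t', ht', htt⟩ := (lcompat_iff _ _).1 hc
    obtain ⟨a, ha, hau, hta⟩ := mem_blockTypes.1 ht
    obtain ⟨b, hb, hbv, htb⟩ := mem_blockTypes.1 ht'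
    have hab : lcompat (L a) (L b) = true := (lcompat_iff _ _).2 ⟨t, hta, t', htb, htt⟩
    refine mem_image.2 ⟨a ∩ b, mem_typeMeets_iff.2 ⟨a, ha, b, hb, hab, rfl⟩, ?_⟩
    rw [inter_sdiff_distrib', hau, hbv]
  · intro hw
    obtain ⟨m, hm, rfl⟩ := mem_image.1 hw
    obtain ⟨a, ha, b, hb, hab, rfl⟩ := mem_typeMeets_iff.1 hm
    refine mem_typeMeets_iff.2 ⟨a \ Y, mem_image.2 ⟨a, ha, rfl⟩, b \ Y, mem_image.2 ⟨b, hb, rfl⟩, ?_,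
      (inter_sdiff_distrib' a b Y).symm⟩
    exact lcompat_mono (subset_blockTypes_sdiff ha) (subset_blockTypes_sdiff hb) hab

/-- Hence the meets of `Z` are at least those of the block projection (`Λ_Y ≥ 0`). [this work] -/
theorem card_typeMeets_block_le :
    #(typeMeets (Z.image fun s => s \ Y) (blockTypes Z L Y)) ≤ #(typeMeets Z L) := by
  rw [typeMeets_block]; exact card_image_le

/-! ### 3. The block step and clean blocks -/

/-- A member inside `Y` makes the block projection a FACE (`∅` is a trace). [this work] -/
theorem empty_mem_blockProj {z : Finset α} (hz : z ∈ Z) (hzY : z ⊆ Y) : (∅ : Finset α) ∈ Z.image fun s => s \ Y :=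
  mem_image.2 ⟨z, hz, sdiff_eq_empty_iff_subset.2 hzY⟩

/-- **THE BLOCK STEP.**  If some member of `Z` lies inside `Y` (so the block projection contains `∅`) and the weight lost in the block projection is at
most twice the number of meets lost (`D_Y ≤ Λ_Y`, written without subtraction), then `Σ_z w(L z) ≤ 2·#typeMeets Z L`.  The face theorem supplies the
inequality for the projection; `typeMeets_block` makes the bookkeeping exact. [this work] -/
theorem block_step (hZG : ∀ z ∈ Z, z ⊆ G) (hcc : ∀ z ∈ Z, G \ z ∈ Z) (hne : ∀ z ∈ Z, (L z).Nonempty)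
    (hflip : ∀ z ∈ Z, L (G \ z) = (L z).image flipT) (hface : ∃ z ∈ Z, z ⊆ Y)
    (hblock : ∑ z ∈ Z, tsWeight (L z) + 2 * #((typeMeets Z L).image fun s => s \ Y) ≤
      ∑ u ∈ Z.image (fun s => s \ Y), tsWeight (blockTypes Z L Y u) + 2 * #(typeMeets Z L)) :
    ∑ z ∈ Z, tsWeight (L z) ≤ 2 * #(typeMeets Z L) := by
  obtain ⟨h1, h2, h3, h4⟩ := blockTypes_config (Y := Y) hZG hcc hne hflip
  obtain ⟨z, hz, hzY⟩ := hface
  have hF := card_add_card_filter_le_two_mul_card_typeMeets_of_empty_mem h1 h2 h3 h4 (empty_mem_blockProj hz hzY)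
  rw [← sum_tsWeight_eq, typeMeets_block] at hF
  omega

/-- The block step in the `#Z + #{self-compatible}` form. [this work] -/
theorem block_step' (hZG : ∀ z ∈ Z, z ⊆ G) (hcc : ∀ z ∈ Z, G \ z ∈ Z) (hne : ∀ z ∈ Z, (L z).Nonempty)
    (hflip : ∀ z ∈ Z, L (G \ z) = (L z).image flipT) (hface : ∃ z ∈ Z, z ⊆ Y)
    (hblock : ∑ z ∈ Z, tsWeight (L z) + 2 * #((typeMeets Z L).image fun s => s \ Y) ≤
      ∑ u ∈ Z.image (fun s => s \ Y), tsWeight (blockTypes Z L Y u) + 2 * #(typeMeets Z L)) :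
    #Z + #(Z.filter fun z => lcompat (L z) (L z) = true) ≤ 2 * #(typeMeets Z L) := by
  rw [← sum_tsWeight_eq]; exact block_step hZG hcc hne hflip hface hblock

/-- With injective traces every block type-set is a single member's type-set, so NO weight is lost. [this work] -/
theorem sum_tsWeight_block_of_injOn (hinj : Set.InjOn (fun z => z \ Y) ↑Z) :
    ∑ u ∈ Z.image (fun s => s \ Y), tsWeight (blockTypes Z L Y u) = ∑ z ∈ Z, tsWeight (L z) := by
  rw [sum_image hinj]
  refine sum_congr rfl fun z hz => ?_
  have : blockTypes Z L Y (z \ Y) = L z := by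
    ext t
    rw [mem_blockTypes]
    constructor
    · rintro ⟨z', hz', he, ht⟩
      have := hinj (mem_coe.2 hz') (mem_coe.2 hz) he
      subst this; exact ht
    · intro ht; exact ⟨z, hz, rfl, ht⟩
  rw [this]

/-- **CLEAN BLOCKS (unconditional `TypeSetSignedDaykin` instance).**  If some member of `Z` lies inside `Y` and the trace map `z ↦ z \ Y` is injective on `Z`,
then `#Z + #{z : L z self-compatible} ≤ 2·#typeMeets Z L`. [this work] -/
theorem card_add_card_filter_le_of_injOn_sdiff (hZG : ∀ z ∈ Z, z ⊆ G) (hcc : ∀ z ∈ Z, G \ z ∈ Z) (hne : ∀ z ∈ Z, (L z).Nonempty)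
    (hflip : ∀ z ∈ Z, L (G \ z) = (L z).image flipT) (hface : ∃ z ∈ Z, z ⊆ Y) (hinj : Set.InjOn (fun z => z \ Y) ↑Z) :
    #Z + #(Z.filter fun z => lcompat (L z) (L z) = true) ≤ 2 * #(typeMeets Z L) := by
  refine block_step' hZG hcc hne hflip hface ?_
  rw [sum_tsWeight_block_of_injOn hinj]
  have := card_image_le (s := typeMeets Z L) (f := fun m => m \ Y)
  omega

end block

/-! ### 4. Signed families: the clean-member theorem, `CrossMemberFace`, and the bridge -/

section signed

variable {F : Finset α} {P : Finset (Finset α)} {κ : Finset α → ℕ}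

/-- Singleton type-sets have weight `1`. [this work] -/
theorem tsWeight_singleton (t : ℕ × Bool) : tsWeight ({t} : Finset (ℕ × Bool)) = 1 := by
  unfold tsWeight
  have : lcompat ({t} : Finset (ℕ × Bool)) {t} ≠ true := by
    intro hh
    rw [lcompat_iff] at hh
    obtain ⟨a, ha, b, hb, h⟩ := hh
    rw [mem_singleton] at ha hb; subst ha; subst hb
    rw [tcompat_eq_true_iff] at h; exact (h.1 rfl) rfl
  rw [if_neg this]

/-- The signed family has total weight `#Z = 2·#P` (all type-sets are singletons). [this work] -/
theorem sum_tsWeight_signed (hPF : ∀ S ∈ P, S ⊆ F) (hcf : ∀ S ∈ P, F \ S ∉ P) :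
    ∑ z ∈ P ∪ P.image (fun S => F \ S), tsWeight (signedTypes F P κ z) = #(P ∪ P.image (fun S => F \ S)) := by
  rw [card_eq_sum_ones]
  refine sum_congr rfl fun z hz => ?_
  rcases mem_union_image_sdiff_iff.1 hz with hzP | ⟨S, hS, rfl⟩
  · rw [signedTypes_of_mem hcf hzP, tsWeight_singleton]
  · rw [signedTypes_of_sdiff_mem hPF hcf hS, tsWeight_singleton]

/-- **THE CLEAN-MEMBER THEOREM (unconditional).**  A complement-free labelled `P ⊆ 2^F` satisfies `#P ≤ #partDiffs F P κ` — for EVERY labelling — as soon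
as some set `Y` contains a member of the signed family `Z = P ⊔ σP` and separates it (`z ↦ z \ Y` injective on `Z`; e.g. `Y = p ∈ P` such that no two
members of `Z` agree outside `p`). [this work] -/
theorem card_le_card_partDiffs_of_injOn_sdiff (hPF : ∀ S ∈ P, S ⊆ F) (hcf : ∀ S ∈ P, F \ S ∉ P) {Y : Finset α}
    (hface : ∃ z ∈ P ∪ P.image (fun S => F \ S), z ⊆ Y)
    (hinj : Set.InjOn (fun z => z \ Y) ↑(P ∪ P.image (fun S => F \ S))) : #P ≤ #(partDiffs F P κ) := by
  obtain ⟨hZG, hcc, hne, hflip, hcardZ⟩ := signed_config (κ := κ) hPF hcf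
  have key := card_add_card_filter_le_of_injOn_sdiff hZG hcc hne hflip hface hinj
  have hsub := card_le_card (typeMeets_signed_subset_partDiffs (κ := κ) hPF hcf)
  have : 2 * #P ≤ 2 * #(partDiffs F P κ) :=
    calc 2 * #P = #(P ∪ P.image (fun S => F \ S)) := hcardZ.symm
      _ ≤ #(P ∪ P.image (fun S => F \ S)) +
            #((P ∪ P.image (fun S => F \ S)).filter fun z =>
              lcompat (signedTypes F P κ z) (signedTypes F P κ z) = true) := Nat.le_add_right _ _
      _ ≤ 2 * #(typeMeets (P ∪ P.image (fun S => F \ S)) (signedTypes F P κ)) := key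
      _ ≤ 2 * #(partDiffs F P κ) := Nat.mul_le_mul_left 2 hsub
  omega

/-- **CONJECTURE (member face; typed) — the order-free form of T_cross.**  Every NONEMPTY crossing labelled configuration `P ⊆ 2^F` (pairwise meeting,
non-covering, cross-label incomparable; labels `< 3`) has a member `p` of its signed family `Z = P ⊔ σP` whose block projection loses at least as much in meets
as in weight: `2·#P + 2·#(typeMeets.image (· \ p)) ≤ Σ_u w(blockTypes Z L p u) + 2·#typeMeets Z L` (i.e. `D_p ≤ Λ_p`; equivalently
`slack(Z) ≥ slack(Z^{(p)})`).  By `block_step` this gives `#P ≤ #partDiffs` (`crossSignedColouredDaykin3_of_crossMemberFace`).  Evidence in the file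
header (it holds for EVERY member, with margin ≥ 1, in all data). [this work] [status: open] -/
@[conjecture] def CrossMemberFace (α : Type*) [DecidableEq α] : Prop :=
  ∀ (F : Finset α) (P : Finset (Finset α)) (κ : Finset α → ℕ), P.Nonempty →
    (∀ S ∈ P, S ⊆ F) → (∀ S ∈ P, κ S < 3) →
    (∀ S ∈ P, ∀ T ∈ P, κ S ≠ κ T → ¬ S ⊆ T) →
    (∀ S ∈ P, ∀ T ∈ P, (S ∩ T).Nonempty ∧ S ∪ T ≠ F) →
    ∃ p ∈ P ∪ P.image (fun S => F \ S),
      2 * #P + 2 * #((typeMeets (P ∪ P.image (fun S => F \ S)) (signedTypes F P κ)).image fun s => s \ p) ≤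
        ∑ u ∈ (P ∪ P.image (fun S => F \ S)).image (fun s => s \ p),
            tsWeight (blockTypes (P ∪ P.image (fun S => F \ S)) (signedTypes F P κ) p u) +
          2 * #(typeMeets (P ∪ P.image (fun S => F \ S)) (signedTypes F P κ))

/-- `CrossMemberFace ⟹` the partition-difference inequality for crossing labelled configurations. [this work] -/
theorem card_le_card_partDiffs_of_crossMemberFace (h : CrossMemberFace α) (F : Finset α) (P : Finset (Finset α))
    (κ : Finset α → ℕ) (hPF : ∀ S ∈ P, S ⊆ F) (hκ : ∀ S ∈ P, κ S < 3) (hinc : ∀ S ∈ P, ∀ T ∈ P, κ S ≠ κ T → ¬ S ⊆ T)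
    (hcross : ∀ S ∈ P, ∀ T ∈ P, (S ∩ T).Nonempty ∧ S ∪ T ≠ F) : #P ≤ #(partDiffs F P κ) := by
  rcases P.eq_empty_or_nonempty with rfl | hP
  · simp
  have hcf : ∀ S ∈ P, F \ S ∉ P := by
    intro S hS hS'
    have hne := (hcross S hS (F \ S) hS').1
    rw [inter_sdiff_self] at hne
    exact Finset.not_nonempty_empty hne
  obtain ⟨p, hp, hblock⟩ := h F P κ hP hPF hκ hinc hcross
  obtain ⟨hZG, hcc, hne, hflip, hcardZ⟩ := signed_config (κ := κ) hPF hcf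
  set Z := P ∪ P.image (fun S => F \ S) with hZ
  set L := signedTypes F P κ with hL
  have hw : ∑ z ∈ Z, tsWeight (L z) = #Z := sum_tsWeight_signed hPF hcf
  have hblock' : ∑ z ∈ Z, tsWeight (L z) + 2 * #((typeMeets Z L).image fun s => s \ p) ≤
      ∑ u ∈ Z.image (fun s => s \ p), tsWeight (blockTypes Z L p u) + 2 * #(typeMeets Z L) := by
    rw [hw, hcardZ]; exact hblock
  have key := block_step hZG hcc hne hflip ⟨p, hp, subset_rfl⟩ hblock'
  rw [hw, hcardZ] at key
  have hsub : #(typeMeets Z L) ≤ #(partDiffs F P κ) :=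
    card_le_card (typeMeets_signed_subset_partDiffs (κ := κ) hPF hcf)
  omega

/-- **THE BRIDGE: `CrossMemberFace ⟹ CrossSignedColouredDaykin3`.** [this work] -/
theorem crossSignedColouredDaykin3_of_crossMemberFace (h : CrossMemberFace α) : CrossSignedColouredDaykin3 α := by
  intro F P c hPF hinc hcross
  have hinc' : ∀ S ∈ P, ∀ T ∈ P, ((c S : ℕ)) ≠ (c T : ℕ) → ¬ S ⊆ T :=
    fun S hS T hT hne => hinc S hS T hT (fun h => hne (by rw [h]))
  have hκ : ∀ S ∈ P, ((c S : ℕ)) < 3 := fun S _ => (c S).isLt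
  have := card_le_card_partDiffs_of_crossMemberFace h F P (fun S => ((c S : ℕ))) hPF hκ hinc' hcross
  rw [partDiffs_val_eq_admDiffs] at this
  exact this.trans (card_admDiffs_le_card_compatJoins hPF)

end signed

end Summit.CriticalPhenomena.PercolationContinuityZ3.Theorems.SahiColouredDaykin
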